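import Literature.NumberTheory.Transcendental.LWMeasureSmallnessComposite
import HarnessLib

/-!
# The Lindemann–Weierstrass measure (Ably 1994, §II) — the maximum-modulus term, final parameters

`Literature/NumberTheory/Transcendental/LWMeasureSmallTermMax.lean` — proofs only (no
definitions, no named facts, nothing asserted). Real-arithmetic bookkeeping for the proof of
Ably's "Proposition principale" behind `Ably1994_lindemannWeierstrass_measure`: the
maximum-modulus / Hermite-decay term of inequality (6), p. 39, in the closed form of
`Setup.norm_aeval_Qj_le_composite` (`LWMeasureSmallnessComposite.lean`, with `R_c = L`),
`|c|^L · s! · (LD · 2^{n(b−1)} bⁿ H A^{n(b−1)} · L^L e^{DL}) · ((2ρ+1)/(L−ρ))^{T'Mⁿ}`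
(`ρ = max(1, M∑|y_k|)`), is at most `e^{−R}/2` under the final parameter relations
(`Mⁿ ≤ L`, `7L ≤ T'Mⁿ ≤ 8L`, `sMⁿ ≤ c L`, `Mⁿ L log M ≤ R ≤ (5/4) L log L ≤ 5R`,
`H ≤ LDbⁿ (L+D)^{T'} K₁(M)^L`, `M ≥ M₀(S, c)`): the polynomial factors contribute
`exp(L log L + O(R/Mⁿ))` while the decay factor is at most `exp(−7L log L + O(R/Mⁿ))`, and
`L log L ≥ (4/5)R` ("Choix des paramètres", pp. 40–41: the term
`exp(L(log L + D) + … − ½T'Mⁿ log L)` of (6)).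

## References

* [Ably1994] M. Ably, *Une version quantitative du théorème de Lindemann–Weierstrass*, Acta Arith.
  67 (1994) 29–45, §II 2e pas (6) p. 39 and "Choix des paramètres" pp. 40–41.
-/

noncomputable section

open MvPolynomial Finset Complex

namespace Literature.NumberTheory.Transcendental

namespace LWMeasure

open Chudnovsky (zl1)

namespace Setup

/-! ### Real-arithmetic helpers -/

/-- Products of factors bounded by exponentials. [folklore] -/
private theorem mul_le_exp_add {a b u v : ℝ} (ha : a ≤ Real.exp u) (hb0 : 0 ≤ b)
    (hb : b ≤ Real.exp v) : a * b ≤ Real.exp (u + v) := by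
  rw [Real.exp_add]
  exact mul_le_mul ha hb hb0 (Real.exp_pos u).le

/-- `x^k = exp(k log x)` for `x > 0`. [folklore] -/
private theorem pow_eq_exp {x : ℝ} (hx : 0 < x) (k : ℕ) :
    x ^ k = Real.exp (k * Real.log x) := by
  rw [Real.exp_nat_mul, Real.exp_log hx]

/-- The Hermite decay factor: for `1 ≤ ρ`, `8ρ ≤ L` and `k ≤ N`,
`((2ρ+1)/(L−ρ))^N ≤ exp(k (log 4ρ − log L))` (the base is at most `4ρ/L ≤ 1/2`). [folklore] -/
private theorem decay_pow_le {ρ L : ℝ} {N k : ℕ} (hρ : 1 ≤ ρ) (hL : 8 * ρ ≤ L) (hkN : k ≤ N) :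
    ((ρ + 1 + ρ) / (L - ρ)) ^ N ≤ Real.exp (k * (Real.log (4 * ρ) - Real.log L)) := by
  have hLρ : 0 < L - ρ := by linarith
  have hL0 : 0 < L := by linarith
  have h4ρ0 : 0 < 4 * ρ := by linarith
  have h0 : 0 ≤ (ρ + 1 + ρ) / (L - ρ) := div_nonneg (by linarith) hLρ.le
  have h1 : (ρ + 1 + ρ) / (L - ρ) ≤ 4 * ρ / L := by
    rw [div_le_div_iff₀ hLρ hL0]
    nlinarith [mul_le_mul_of_nonneg_right hL (by linarith : (0 : ℝ) ≤ 2 * ρ - 1),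
      mul_le_mul_of_nonneg_right hρ (by linarith : (0 : ℝ) ≤ ρ)]
  have h2 : 4 * ρ / L ≤ 1 := (div_le_one hL0).mpr (by linarith)
  have h4ρ : 0 < 4 * ρ / L := div_pos h4ρ0 hL0
  calc ((ρ + 1 + ρ) / (L - ρ)) ^ N ≤ ((ρ + 1 + ρ) / (L - ρ)) ^ k :=
        pow_le_pow_of_le_one h0 (h1.trans h2) hkN
    _ ≤ (4 * ρ / L) ^ k := pow_le_pow_left₀ h0 h1 k
    _ = Real.exp (k * (Real.log (4 * ρ) - Real.log L)) := by
        rw [pow_eq_exp h4ρ, Real.log_div h4ρ0.ne' hL0.ne']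

/-- `K₁(M) ≤ M K₁(1)` (`M ≥ 1`). [folklore] -/
private theorem K₁_le_mul (S : Setup) {M : ℕ} (hM : 1 ≤ M) : S.K₁ M ≤ (M : ℝ) * S.K₁ 1 := by
  simp only [Setup.K₁, Nat.cast_one, one_mul]
  have hM1 : (1 : ℝ) ≤ M := by exact_mod_cast hM
  have hZ : (0 : ℝ) ≤ (1 + zl1 S.μ) ^ S.dR :=
    pow_nonneg (add_nonneg zero_le_one (apply_nonneg _ _)) _
  have hcZ : 0 ≤ |(S.c : ℝ)| * (1 + zl1 S.μ) ^ S.dR := mul_nonneg (abs_nonneg _) hZ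
  have hAR := S.AR_nonneg
  have key : (M : ℝ) * (|(S.c : ℝ)| * (1 + S.AR) * (1 + zl1 S.μ) ^ S.dR) -
      |(S.c : ℝ)| * (1 + M * S.AR) * (1 + zl1 S.μ) ^ S.dR =
      |(S.c : ℝ)| * (1 + zl1 S.μ) ^ S.dR * (M - 1) := by ring
  nlinarith [mul_nonneg hcZ (by linarith : (0 : ℝ) ≤ M - 1)]

/-! ### The maximum-modulus term -/

/-- **The maximum-modulus term of (6), p. 39, under the final parameters.** For the data `S` and a
constant `c_{ST}` there is `M₀` such that for all naturals `L, D, b, M, T', s` and reals `H, R`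
with `M ≥ M₀`, `Mⁿ ≤ L`, `1 ≤ D ≤ 2^{n+4} d`, `1 ≤ b ≤ DM`, `7L ≤ T'Mⁿ ≤ 8L`, `sMⁿ ≤ c_{ST} L`,
`Mⁿ L log M ≤ R ≤ (5/4) L log L`, `L log L ≤ 4R`, `0 ≤ H ≤ LDbⁿ (L+D)^{T'} K₁(M)^L`, the term
`|c|^L s! (LD 2^{n(b−1)} bⁿ H A^{n(b−1)} L^L e^{DL}) ((2ρ+1)/(L−ρ))^{T'Mⁿ}` (`ρ = max(1, M∑|y_k|)`,
the maximum-modulus bound `B = |f|_{L}` of `Setup.norm_F_le` times the Hermite decay at `R_c = L`)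
is at most `e^{−R}/2`. [cite: Ably1994, §II 2e pas (6) p. 39, Choix des paramètres pp. 40–41] -/
theorem small_term_max (S : Setup) (cST : ℕ) :
    ∃ M₀ : ℕ, ∀ (L D b M T' s : ℕ) (H R : ℝ),
      M₀ ≤ M → M ^ S.n ≤ L → 1 ≤ D → D ≤ 2 ^ (S.n + 4) * S.d → 1 ≤ b → b ≤ D * M →
      T' * M ^ S.n ≤ 8 * L → 7 * L ≤ T' * M ^ S.n → s * M ^ S.n ≤ cST * L →
      (M : ℝ) ^ S.n * L * Real.log M ≤ R → R ≤ 5 / 4 * L * Real.log L → L * Real.log L ≤ 4 * R →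
      0 ≤ H → H ≤ ((L * D * b ^ S.n : ℕ) : ℝ) * (((L : ℝ) + D) ^ T' * S.K₁ M ^ L) →
      |(S.c : ℝ)| ^ L * ((s.factorial : ℝ) *
          (((L : ℝ) * D * (2 ^ (S.n * (b - 1)) * ((b : ℝ) ^ S.n * H) * S.A ^ (S.n * (b - 1))) *
              (L : ℝ) ^ L * Real.exp (D * (L : ℝ))) *
            ((ptsRad S.y M + 1 + ptsRad S.y M) / ((L : ℝ) - ptsRad S.y M)) ^ (T' * M ^ S.n))) ≤
        Real.exp (-R) / 2 := by
  -- the constants of `S` (opaque reals with their defining equations)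
  obtain ⟨cy, hcy⟩ : ∃ cy : ℝ, cy = 1 + ∑ k, ‖S.y k‖ := ⟨_, rfl⟩
  obtain ⟨lc, hlc⟩ : ∃ lc : ℝ, lc = Real.log |(S.c : ℝ)| := ⟨_, rfl⟩
  obtain ⟨lK, hlK⟩ : ∃ lK : ℝ, lK = Real.log (S.K₁ 1) := ⟨_, rfl⟩
  obtain ⟨lA, hlA⟩ : ∃ lA : ℝ, lA = Real.log S.A := ⟨_, rfl⟩
  obtain ⟨ly, hly⟩ : ∃ ly : ℝ, ly = Real.log (4 * cy) := ⟨_, rfl⟩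
  obtain ⟨Dm, hDm⟩ : ∃ Dm : ℕ, Dm = 2 ^ (S.n + 4) * S.d := ⟨_, rfl⟩
  obtain ⟨K, hK⟩ : ∃ K : ℝ,
      K = lc + 4 * cST + 3 * S.n * Dm + S.n * Dm * lA + Dm + lK + 7 * ly + 76 := ⟨_, rfl⟩
  have hcy1 : 1 ≤ cy := by
    rw [hcy]; linarith [Finset.sum_nonneg fun k (_ : k ∈ univ) => norm_nonneg (S.y k)]
  have hc1 := S.one_le_abs_c
  have hc0 : 0 < |(S.c : ℝ)| := lt_of_lt_of_le one_pos hc1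
  have hlc0 : 0 ≤ lc := by rw [hlc]; exact Real.log_nonneg hc1
  have hA1 := S.one_le_A
  have hA0 : 0 ≤ S.A := zero_le_one.trans hA1
  have hlA0 : 0 ≤ lA := by rw [hlA]; exact Real.log_nonneg hA1
  have hK11 : 1 ≤ S.K₁ 1 := S.one_le_K₁ 1
  have hlK0 : 0 ≤ lK := by rw [hlK]; exact Real.log_nonneg hK11
  have hly0 : 0 ≤ ly := by rw [hly]; exact Real.log_nonneg (by linarith)
  have h2e : (2 : ℝ) ≤ Real.exp 1 := by linarith [Real.add_one_le_exp (1 : ℝ)]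
  refine ⟨⌈K⌉₊ + ⌈Real.exp (10 * cy)⌉₊ + Dm + cST + 3, fun L D b M T' s H R hM hML _hD1 hDle _hb1
    hbDM hT8 hT7 hs hR1 hR2 hR3 hH0 hH => ?_⟩
  rw [← hDm] at hDle
  -- sizes of `M`
  have hM3 : 3 ≤ M := by omega
  have hcM : cST ≤ M := by omega
  have hDmM : Dm ≤ M := by omega
  have hEM : ⌈Real.exp (10 * cy)⌉₊ ≤ M := by omega
  have hKM : ⌈K⌉₊ ≤ M := by omega
  have hn0 : S.n ≠ 0 := by have := S.one_le_n; omega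
  have hM1 : (1 : ℝ) ≤ M := by exact_mod_cast (by omega : 1 ≤ M)
  have hM0 : (0 : ℝ) < M := lt_of_lt_of_le one_pos hM1
  -- `P = Mⁿ`, `X = R / Mⁿ`
  obtain ⟨P, hP⟩ : ∃ P : ℝ, P = (M : ℝ) ^ S.n := ⟨_, rfl⟩
  rw [← hP] at hR1
  have hMP : (M : ℝ) ≤ P := hP ▸ le_self_pow₀ hM1 hn0
  have hPL : P ≤ L := by rw [hP]; exact_mod_cast hML
  have hP0 : 0 < P := lt_of_lt_of_le hM0 hMP
  have hL1 : (1 : ℝ) ≤ L := hM1.trans (hMP.trans hPL)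
  have hL0 : (0 : ℝ) < L := lt_of_lt_of_le one_pos hL1
  have hlM : 10 * cy ≤ Real.log M := by
    rw [Real.le_log_iff_exp_le hM0]
    exact (Nat.le_ceil _).trans (by exact_mod_cast hEM)
  have hlM1 : 1 ≤ Real.log M := by linarith only [hlM, hcy1]
  have hlL0 : 0 ≤ Real.log L := Real.log_nonneg hL1
  have hlLL : Real.log L ≤ L := Real.log_le_self hL0.le
  obtain ⟨X, hX⟩ : ∃ X : ℝ, X = R / P := ⟨_, rfl⟩
  have hLX : L * Real.log M ≤ X := by
    rw [hX, le_div_iff₀ hP0]; linarith only [hR1]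
  have hXL : (L : ℝ) ≤ X := le_trans (le_mul_of_one_le_right hL0.le hlM1) hLX
  have hXM : (M : ℝ) ≤ X := hMP.trans (hPL.trans hXL)
  have hXlL : Real.log L ≤ X := hlLL.trans hXL
  have hR0 : 1 ≤ R := by
    have : 1 ≤ P * L * Real.log M :=
      one_le_mul_of_one_le_of_one_le (one_le_mul_of_one_le_of_one_le (hM1.trans hMP) hL1) hlM1
    linarith only [this, hR1]
  have h45 : 4 / 5 * R ≤ L * Real.log L := by linarith only [hR2]
  -- `s log L ≤ 4 c X`, `T' log L ≤ 32 X`, `s ≤ L`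
  have hsP : (s : ℝ) * P ≤ cST * L := by rw [hP]; exact_mod_cast hs
  have hsX : (s : ℝ) * Real.log L ≤ 4 * cST * X := by
    rw [hX, show 4 * (cST : ℝ) * (R / P) = 4 * cST * R / P by ring, le_div_iff₀ hP0]
    linarith only [mul_le_mul_of_nonneg_right hsP hlL0,
      mul_le_mul_of_nonneg_left hR3 (Nat.cast_nonneg cST)]
  have hTP : (T' : ℝ) * P ≤ 8 * L := by rw [hP]; exact_mod_cast hT8
  have hTX : (T' : ℝ) * Real.log L ≤ 32 * X := by
    rw [hX, show (32 : ℝ) * (R / P) = 32 * R / P by ring, le_div_iff₀ hP0]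
    linarith only [mul_le_mul_of_nonneg_right hTP hlL0, hR3]
  have hsL : (s : ℝ) ≤ L := by
    have hcP : (cST : ℝ) ≤ P := le_trans (by exact_mod_cast hcM) hMP
    refine le_of_mul_le_mul_right ?_ hP0
    calc (s : ℝ) * P ≤ cST * L := hsP
      _ ≤ P * L := mul_le_mul_of_nonneg_right hcP hL0.le
      _ = L * P := mul_comm _ _
  -- `D`, `b`
  have hDDm : (D : ℝ) ≤ Dm := by exact_mod_cast hDle
  have hDL : (D : ℝ) ≤ L :=
    hDDm.trans ((by exact_mod_cast hDmM : (Dm : ℝ) ≤ M).trans (hMP.trans hPL))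
  have hDX : (D : ℝ) * L ≤ Dm * X := mul_le_mul hDDm hXL hL0.le (Nat.cast_nonneg _)
  have hb0 : (0 : ℝ) ≤ b := Nat.cast_nonneg _
  have hbX : (b : ℝ) ≤ Dm * X := by
    have : (b : ℝ) ≤ D * M := by exact_mod_cast hbDM
    exact this.trans (mul_le_mul hDDm hXM hM0.le (Nat.cast_nonneg _))
  have hnb : (S.n : ℝ) * b ≤ S.n * (Dm * X) := mul_le_mul_of_nonneg_left hbX (Nat.cast_nonneg _)
  have hb1 : S.n * (b - 1) ≤ S.n * b := Nat.mul_le_mul_left _ (Nat.sub_le b 1)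
  -- the radius `ρ ≤ M cy ≤ L/8`
  have hρ1 : 1 ≤ ptsRad S.y M := one_le_ptsRad _ _
  have hρ : ptsRad S.y M ≤ M * cy := by rw [hcy]; exact S.ptsRad_le (by omega)
  have hPlM : P * Real.log M ≤ 5 / 4 * Real.log L := by
    refine le_of_mul_le_mul_left ?_ hL0
    linarith only [hR1, hR2]
  have hL8 : 8 * (M * cy) ≤ (L : ℝ) := by
    have h1 : (M : ℝ) * (10 * cy) ≤ P * Real.log M :=
      mul_le_mul hMP hlM (by linarith only [hcy1]) hP0.le
    linarith only [h1, hPlM, hlLL]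
  have hρL : 8 * ptsRad S.y M ≤ (L : ℝ) := by linarith only [hρ, hL8]
  -- the eleven factors
  have h1 : |(S.c : ℝ)| ^ L ≤ Real.exp (lc * X) := by
    rw [pow_eq_exp hc0, ← hlc]
    exact Real.exp_le_exp.mpr (by linarith only [mul_le_mul_of_nonneg_left hXL hlc0])
  have h2 : (s.factorial : ℝ) ≤ Real.exp (4 * cST * X) := by
    calc (s.factorial : ℝ) ≤ (s : ℝ) ^ s := by exact_mod_cast Nat.factorial_le_pow s
      _ ≤ (L : ℝ) ^ s := pow_le_pow_left₀ (Nat.cast_nonneg _) hsL s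
      _ = Real.exp (s * Real.log L) := pow_eq_exp hL0 s
      _ ≤ Real.exp (4 * cST * X) := Real.exp_le_exp.mpr hsX
  have h3 : (L : ℝ) ≤ Real.exp X := by
    calc (L : ℝ) = Real.exp (Real.log L) := (Real.exp_log hL0).symm
      _ ≤ Real.exp X := Real.exp_le_exp.mpr hXlL
  have h4 : (D : ℝ) ≤ Real.exp X := hDL.trans h3
  have h5 : (2 : ℝ) ^ (S.n * (b - 1)) ≤ Real.exp (S.n * Dm * X) := by
    calc (2 : ℝ) ^ (S.n * (b - 1)) ≤ (2 : ℝ) ^ (S.n * b) := pow_le_pow_right₀ (by norm_num) hb1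
      _ ≤ Real.exp 1 ^ (S.n * b) := pow_le_pow_left₀ (by norm_num) h2e _
      _ = Real.exp ((S.n * b : ℕ) * 1) := (Real.exp_nat_mul _ _).symm
      _ ≤ Real.exp (S.n * Dm * X) := Real.exp_le_exp.mpr (by push_cast; linarith only [hnb])
  have h6 : (b : ℝ) ^ S.n ≤ Real.exp (S.n * Dm * X) := by
    calc (b : ℝ) ^ S.n ≤ Real.exp b ^ S.n :=
          pow_le_pow_left₀ hb0 (by linarith only [Real.add_one_le_exp (b : ℝ)]) _
      _ = Real.exp (S.n * b) := (Real.exp_nat_mul _ _).symm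
      _ ≤ Real.exp (S.n * Dm * X) := Real.exp_le_exp.mpr (by linarith only [hnb])
  have hK0 : 0 ≤ S.K₁ M := zero_le_one.trans (S.one_le_K₁ M)
  have hK10 : 0 < S.K₁ 1 := lt_of_lt_of_le one_pos hK11
  have hKL : S.K₁ M ^ L ≤ Real.exp (lK * X + X) := by
    have hMK : 0 < (M : ℝ) * S.K₁ 1 := mul_pos hM0 hK10
    calc S.K₁ M ^ L ≤ ((M : ℝ) * S.K₁ 1) ^ L :=
          pow_le_pow_left₀ hK0 (K₁_le_mul S (by omega)) L
      _ = Real.exp (L * (Real.log M + lK)) := by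
          rw [pow_eq_exp hMK L, Real.log_mul hM0.ne' hK10.ne', ← hlK]
      _ ≤ Real.exp (lK * X + X) :=
          Real.exp_le_exp.mpr (by linarith only [mul_le_mul_of_nonneg_left hXL hlK0, hLX])
  have hLD : ((L : ℝ) + D) ^ T' ≤ Real.exp (64 * X) := by
    have hL2 : (2 : ℝ) ≤ L := by
      have : (3 : ℝ) ≤ M := by exact_mod_cast hM3
      linarith only [this, hMP, hPL]
    have hle : (L : ℝ) + D ≤ L * L := by
      linarith only [mul_le_mul_of_nonneg_right hL2 hL0.le, hDL]
    calc ((L : ℝ) + D) ^ T' ≤ ((L : ℝ) * L) ^ T' := pow_le_pow_left₀ (by positivity) hle T'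
      _ = Real.exp (T' * (Real.log L + Real.log L)) := by
          rw [pow_eq_exp (by positivity) T', Real.log_mul hL0.ne' hL0.ne']
      _ ≤ Real.exp (64 * X) := Real.exp_le_exp.mpr (by linarith only [hTX])
  have hLDb : ((L * D * b ^ S.n : ℕ) : ℝ) ≤ Real.exp (X + X + S.n * Dm * X) := by
    push_cast
    exact mul_le_exp_add (mul_le_exp_add h3 (Nat.cast_nonneg _) h4) (pow_nonneg hb0 _) h6
  have h7 : H ≤ Real.exp (X + X + S.n * Dm * X + (64 * X + (lK * X + X))) :=
    hH.trans (mul_le_exp_add hLDb (mul_nonneg (pow_nonneg (by positivity) _) (pow_nonneg hK0 _))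
      (mul_le_exp_add hLD (pow_nonneg hK0 L) hKL))
  have h8 : S.A ^ (S.n * (b - 1)) ≤ Real.exp (S.n * Dm * lA * X) := by
    calc S.A ^ (S.n * (b - 1)) ≤ S.A ^ (S.n * b) := pow_le_pow_right₀ hA1 hb1
      _ = Real.exp ((S.n * b : ℕ) * lA) := by
          rw [pow_eq_exp (lt_of_lt_of_le one_pos hA1) (S.n * b), ← hlA]
      _ ≤ Real.exp (S.n * Dm * lA * X) :=
          Real.exp_le_exp.mpr (by push_cast; linarith only [mul_le_mul_of_nonneg_right hnb hlA0])
  have h9 : (L : ℝ) ^ L ≤ Real.exp (L * Real.log L) := (pow_eq_exp hL0 L).le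
  have h10 : Real.exp (D * (L : ℝ)) ≤ Real.exp (Dm * X) := Real.exp_le_exp.mpr hDX
  have hY0 : 0 ≤ ((ptsRad S.y M + 1 + ptsRad S.y M) / ((L : ℝ) - ptsRad S.y M)) ^ (T' * M ^ S.n) :=
    pow_nonneg (div_nonneg (by linarith only [hρ1]) (by linarith only [hρ1, hρL])) _
  have h11 : ((ptsRad S.y M + 1 + ptsRad S.y M) / ((L : ℝ) - ptsRad S.y M)) ^ (T' * M ^ S.n) ≤
      Real.exp (7 * ly * X + 7 * X - 7 * (L * Real.log L)) := by
    refine (decay_pow_le hρ1 hρL hT7).trans (Real.exp_le_exp.mpr ?_)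
    have hlog : Real.log (4 * ptsRad S.y M) ≤ ly + Real.log M := by
      have h4cy : (0 : ℝ) < 4 * cy := by linarith only [hcy1]
      rw [hly, ← Real.log_mul h4cy.ne' hM0.ne']
      exact Real.log_le_log (by linarith only [hρ1]) (by linarith only [hρ])
    push_cast
    linarith only [mul_le_mul_of_nonneg_left hlog (by positivity : (0 : ℝ) ≤ 7 * L),
      mul_le_mul_of_nonneg_left hXL hly0, hLX]
  -- the product
  have hmain : _ ≤ Real.exp _ :=
    mul_le_exp_add h1 (mul_nonneg (Nat.cast_nonneg _) (mul_nonneg (by positivity) hY0))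
      (mul_le_exp_add h2 (mul_nonneg (by positivity) hY0)
        (mul_le_exp_add
          (mul_le_exp_add
            (mul_le_exp_add
              (mul_le_exp_add (mul_le_exp_add h3 (Nat.cast_nonneg D) h4) (by positivity)
                (mul_le_exp_add (mul_le_exp_add h5 (by positivity) (mul_le_exp_add h6 hH0 h7))
                  (by positivity) h8))
              (by positivity) h9)
            (by positivity) h10)
          hY0 h11))
  refine hmain.trans (le_trans (b := Real.exp (-R - 1)) (Real.exp_le_exp.mpr ?_) ?_)
  · -- the exponent
    have hKX : K * X ≤ R := by
      have hKP : K ≤ P :=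
        (Nat.le_ceil K).trans ((by exact_mod_cast hKM : (⌈K⌉₊ : ℝ) ≤ M).trans hMP)
      rw [hX, ← mul_div_assoc, div_le_iff₀ hP0]
      linarith only [mul_le_mul_of_nonneg_left hKP (by linarith only [hR0] : (0 : ℝ) ≤ R)]
    rw [hK] at hKX
    linarith only [hKX, h45, hR0]
  · have : Real.exp (-R) = Real.exp (-R - 1) * Real.exp 1 := by
      rw [← Real.exp_add]; congr 1; ring
    rw [this, le_div_iff₀ (by norm_num : (0 : ℝ) < 2)]
    exact mul_le_mul_of_nonneg_left h2e (Real.exp_pos _).le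

end Setup

end LWMeasure

end Literature.NumberTheory.Transcendental

end
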